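import Literature.Geometry.Lorentzian.SpacelikeCompleteGraph
import HarnessLib

/-!
# The slope of a developed slice is read off its unit normal: `‖∇u‖² = 1 − (ν⁰)⁻²`

Sequel to `SpacelikeCompleteGraph.lean`. For a smooth map `f : X → (ℝ⁴, η)`, a diffeomorphism
`Φ : X ≅ ℝ³` with `f ∘ Φ⁻¹` the graph of a differentiable `u`, and a field `ν` along `f` normal
to `df(TX)`, the slope of the graph is the spatial part of `ν` over its time part,
`ν⁰ ∇u = π ν` (Wald 1984, §10.2: `n_a = −N ∇_a t`, `N` the lapse); for a timelike UNIT normal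
`(ν⁰)² = 1 + ‖π ν‖²`, so `‖∇u‖² = 1 − (ν⁰)⁻²`. Consequently the uniform slope bound
`‖du‖ ≤ θ < 1` required by the Cauchy criterion `isCauchyHypersurface_range_of_slope_le` is
EQUIVALENT to the boundedness of `ν⁰` on `X` — for the developing map of the translational KIDs
(`KIDGlobalImmersion.lean`: `ν = (−ε_a N_a)_a`) the boundedness of the lapse `N₀` of the timelike
KID, which is how asymptotic flatness enters the last step of Beig–Chruściel 1996, Thm. 4.1.

* `InitialDataSet.time_smul_gradient_height_eq_spatial_normal` — `ν⁰ ∇u(y) = π ν` at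
  `x = Φ⁻¹ y`;
* `InitialDataSet.norm_gradient_height_sq_eq` — `(ν⁰)² ≥ 1` and `‖∇u(y)‖² = 1 − (ν⁰)⁻²`;
* `InitialDataSet.exists_slope_le_of_time_normal_le` — `0 < ν⁰ ≤ B` on `X` ⟹
  `‖du‖ ≤ √(1 − B⁻²) < 1` on `ℝ³`.

Theorems only; no definitions, no named facts.

## References

* R. M. Wald, *General Relativity*, Chicago 1984, §10.2, (10.2.8)–(10.2.9). [Wald1984]
* R. Beig, P. T. Chruściel, J. Math. Phys. 37 (1996) 1939–1961, proof of Thm. 4.1, §4.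
  [BeigChrusciel1996]
-/

noncomputable section

open Bundle Set Function Filter Manifold
open scoped Manifold ContDiff Topology RealInnerProductSpace Gradient NNReal

namespace Literature.Geometry.Lorentzian

open PseudoRiemannianMetric

namespace InitialDataSet

variable {X : Type*} [TopologicalSpace X] [ChartedSpace E3 X]

/-- **The slope of a graph is the spatial part of its unit normal over the time part.** Let
`f : X → (ℝ⁴, η)` be smooth, `Φ : X ≅ ℝ³` a diffeomorphism with `f ∘ Φ⁻¹` the graph map of a
differentiable `u : ℝ³ → ℝ`, and `ν` a field along `f` normal to `df(TX)`. Then at `y = Φ x`: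
`ν⁰ ∇u(y) = π(ν)` — the tangent plane of the graph at `f x` is `{(⟪∇u, w⟫, w)}`, and
`η(ν, (⟪∇u, w⟫, w)) = −ν⁰⟪∇u, w⟫ + ⟪π ν, w⟫ = 0` for all `w`. Wald 1984, §10.2 (the unit normal
`n^a = −N ∇^a t` of a slicing; lapse `N = (−∇t · ∇t)^{-1/2}`).
[cite: Wald1984, §10.2 (10.2.8)–(10.2.9)] -/
theorem time_smul_gradient_height_eq_spatial_normal {f : X → E4}
    (hfs : ContMDiff (𝓡 3) 𝓘(ℝ, E4) ∞ f) (Φ : X ≃ₘ^∞⟮𝓡 3, 𝓘(ℝ, E3)⟯ E3) {u : E3 → ℝ}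
    (hu : Differentiable ℝ u) (hgraph : ∀ y, f (Φ.symm y) = E4.ofTimeSpace (u y) y)
    {ν : X → E4} (hn : Minkowski.smoothMetric.toPseudoRiemannianMetric.IsNormalTo (𝓡 3) f ν)
    (y : E3) : E4.time (ν (Φ.symm y)) • ∇ u y = E4.spatial (ν (Φ.symm y)) := by
  set x := Φ.symm y with hx
  have hΦd : MDifferentiableAt 𝓘(ℝ, E3) (𝓡 3) Φ.symm y :=
    (Φ.symm.contMDiff y).mdifferentiableAt (by simp)
  have hfun : (fun y ↦ f (Φ.symm y)) = fun y : E3 ↦ E4.ofTimeSpace (u y) y := funext hgraph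
  -- tangent vectors of the graph are tangent vectors of `f`
  have htan : ∀ w : E3, mfderiv (𝓡 3) 𝓘(ℝ, E4) f x (mfderiv 𝓘(ℝ, E3) (𝓡 3) Φ.symm y w) =
      E4.ofTimeSpace ⟪∇ u y, w⟫ w := by
    intro w
    have h1 : mfderiv 𝓘(ℝ, E3) 𝓘(ℝ, E4) (fun y ↦ f (Φ.symm y)) y w =
        mfderiv (𝓡 3) 𝓘(ℝ, E4) f x (mfderiv 𝓘(ℝ, E3) (𝓡 3) Φ.symm y w) := by
      rw [show (fun y ↦ f (Φ.symm y)) = f ∘ Φ.symm from rfl,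
        mfderiv_comp y ((hfs _).mdifferentiableAt (by simp)) hΦd]
      rfl
    rw [← h1, hfun, mfderiv_eq_fderiv]
    exact Minkowski.fderiv_graph_apply_eq_gradient (hu y) w
  -- normality against all of them
  have horth : ∀ w : E3, ⟪E4.time (ν x) • ∇ u y - E4.spatial (ν x), w⟫ = 0 := by
    intro w
    have h0 := hn x (mfderiv 𝓘(ℝ, E3) (𝓡 3) Φ.symm y w)
    rw [htan w] at h0
    change Minkowski.bilin (ν x) (E4.ofTimeSpace ⟪∇ u y, w⟫ w) = 0 at h0
    rw [Minkowski.bilin_eq_neg_time_mul_add_inner_spatial, E4.time_ofTimeSpace,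
      E4.spatial_ofTimeSpace] at h0
    rw [inner_sub_left, real_inner_smul_left]
    linarith [real_inner_comm (E4.spatial (ν x)) w]
  have h := horth (E4.time (ν x) • ∇ u y - E4.spatial (ν x))
  rw [real_inner_self_eq_norm_sq, sq_eq_zero_iff, norm_eq_zero, sub_eq_zero] at h
  exact h

/-- **`‖∇u‖² = 1 − 1/(ν⁰)²` for a timelike unit normal.** Under the hypotheses of
`time_smul_gradient_height_eq_spatial_normal` with `ν` a unit timelike normal (`η(ν, ν) = −1`):
`(ν⁰)² = 1 + ‖π ν‖² ≥ 1` and `‖∇u(Φ x)‖² = 1 − (ν⁰(x))⁻²`. In particular the slope of the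
developed slice is uniformly `< 1` iff the time component of its unit normal — the lapse `N₀` of
the timelike translational KID, `ν = (−ε_a N_a)_a` — is bounded (Wald 1984, (10.2.9):
`N = (ν⁰)` for the `t`-slicing of Minkowski space-time).
[cite: Wald1984, §10.2 (10.2.8)–(10.2.9)] -/
theorem norm_gradient_height_sq_eq {f : X → E4}
    (hfs : ContMDiff (𝓡 3) 𝓘(ℝ, E4) ∞ f) (Φ : X ≃ₘ^∞⟮𝓡 3, 𝓘(ℝ, E3)⟯ E3) {u : E3 → ℝ}
    (hu : Differentiable ℝ u) (hgraph : ∀ y, f (Φ.symm y) = E4.ofTimeSpace (u y) y)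
    {ν : X → E4}
    (hun : Minkowski.smoothMetric.toPseudoRiemannianMetric.IsUnitNormal (𝓡 3) f ν (-1))
    (y : E3) :
    1 ≤ E4.time (ν (Φ.symm y)) ^ 2 ∧
      ‖∇ u y‖ ^ 2 = 1 - (E4.time (ν (Φ.symm y)) ^ 2)⁻¹ := by
  have hsm := time_smul_gradient_height_eq_spatial_normal hfs Φ hu hgraph hun.1 y
  have hunit : Minkowski.bilin (ν (Φ.symm y)) (ν (Φ.symm y)) = -1 := hun.2 (Φ.symm y)
  rw [Minkowski.bilin_self_eq_norm_spatial_sq_sub, ← hsm, norm_smul, mul_pow,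
    Real.norm_eq_abs, sq_abs] at hunit
  -- `hunit : t² ‖∇u‖² − t² = −1`
  have ht : 1 ≤ E4.time (ν (Φ.symm y)) ^ 2 := by
    nlinarith [sq_nonneg (E4.time (ν (Φ.symm y))), sq_nonneg ‖∇ u y‖,
      mul_nonneg (sq_nonneg (E4.time (ν (Φ.symm y)))) (sq_nonneg ‖∇ u y‖)]
  refine ⟨ht, ?_⟩
  have ht0 : E4.time (ν (Φ.symm y)) ^ 2 ≠ 0 := by positivity
  have h1 : ‖∇ u y‖ ^ 2 = (E4.time (ν (Φ.symm y)) ^ 2 - 1) / E4.time (ν (Φ.symm y)) ^ 2 := by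
    rw [eq_div_iff ht0]
    linarith
  rw [h1, sub_div, div_self ht0, one_div]

/-- **Bounded lapse ⟹ uniform slope bound.** If moreover the time component of the unit normal
is bounded, `ν⁰ ≤ B` on `X`, then `‖du‖ ≤ θ` everywhere on `ℝ³` with
`θ = √(1 − B⁻²) < 1` (`Φ` is onto). This turns the Cauchy criterion
`isCauchyHypersurface_range_of_slope_le` into a criterion on the lapse.
[cite: BeigChrusciel1996, proof of Thm. 4.1, §4 (last paragraph)] -/
theorem exists_slope_le_of_time_normal_le {f : X → E4}
    (hfs : ContMDiff (𝓡 3) 𝓘(ℝ, E4) ∞ f) (Φ : X ≃ₘ^∞⟮𝓡 3, 𝓘(ℝ, E3)⟯ E3) {u : E3 → ℝ}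
    (hu : Differentiable ℝ u) (hgraph : ∀ y, f (Φ.symm y) = E4.ofTimeSpace (u y) y)
    {ν : X → E4}
    (hun : Minkowski.smoothMetric.toPseudoRiemannianMetric.IsUnitNormal (𝓡 3) f ν (-1))
    {B : ℝ} (hB : ∀ x, E4.time (ν x) ≤ B) (hpos : ∀ x, 0 < E4.time (ν x)) :
    ∃ θ : ℝ≥0, θ < 1 ∧ ∀ y, ‖fderiv ℝ u y‖₊ ≤ θ := by
  have hB1 : 1 ≤ B := by
    have h1 := (norm_gradient_height_sq_eq hfs Φ hu hgraph hun 0).1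
    have h2 := hB (Φ.symm 0)
    have h3 := hpos (Φ.symm 0)
    nlinarith
  have hB0 : 0 < B := by linarith
  set θr : ℝ := Real.sqrt (1 - (B ^ 2)⁻¹) with hθr
  have hθr0 : 0 ≤ θr := Real.sqrt_nonneg _
  have hθr1 : θr < 1 := by
    rw [hθr, Real.sqrt_lt' one_pos, one_pow]
    have : 0 < (B ^ 2)⁻¹ := by positivity
    linarith
  refine ⟨⟨θr, hθr0⟩, by exact_mod_cast hθr1, fun y ↦ ?_⟩
  -- `‖du_y‖ = ‖∇u(y)‖ ≤ θ`
  set x := Φ.symm y with hx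
  obtain ⟨ht1, hgrad⟩ := norm_gradient_height_sq_eq hfs Φ hu hgraph hun y
  have hle : ‖∇ u y‖ ^ 2 ≤ θr ^ 2 := by
    rw [hgrad, hθr, Real.sq_sqrt (by
      have : (B ^ 2)⁻¹ ≤ 1 := inv_le_one_of_one_le₀ (by nlinarith)
      linarith)]
    have h1 : E4.time (ν x) ^ 2 ≤ B ^ 2 := by
      have := hB x
      have := hpos x
      nlinarith
    have h2 : (B ^ 2)⁻¹ ≤ (E4.time (ν x) ^ 2)⁻¹ :=
      inv_anti₀ (by positivity) h1
    linarith
  have hnorm : ‖fderiv ℝ u y‖ = ‖∇ u y‖ := by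
    rw [gradient, LinearIsometryEquiv.norm_map]
  have hle' : ‖∇ u y‖ ≤ θr := (pow_le_pow_iff_left₀ (norm_nonneg _) hθr0 two_ne_zero).1 hle
  rw [← NNReal.coe_le_coe, coe_nnnorm]
  show ‖fderiv ℝ u y‖ ≤ θr
  rw [hnorm]
  exact hle'

end InitialDataSet

end Literature.Geometry.Lorentzian

end
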